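import Summits.QuantumFields.BalabanUV.Beta.GAN24.FineReadoutCauchyScalars

/-!
# `BalabanUV.Beta.GAN24.FineReadoutCauchyAmp` — binder row G-an2-4 / (CONV-C), S-slot located remainder «E3SupRate», located leaf «(N1-Cauchy)»
# (owner spec `HOME/b2b-balaban-gan24-p1/N1-CAUCHY-SPEC.md`, holder division `…/leaf-17/g11/N1-CAUCHY-DIVISION.md`), PART A «matched sub-alias»,
# part 2/3: THE MODEL AMPLITUDE — N-UNIFORM BOUND AND TWO-LEVEL RATE WITH ABSTRACT CAPACITANCE DATA

NOT IN PRINT; OUR PROOF ATTEMPT (of the road; THIS file is [folklore] bookkeeping: products and quotients of the scalar ingredients of part 1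
(`GAN24/FineReadoutCauchyScalars`) and of `FibreRateTBlockRate`'s scaled Laplacian symbol `ℓ_N` BY NAME, telescoped with leaf-14's
`ClosedFormRateOfParts.norm_mul3_sub_mul3_le_of_bounds`; no cited fact, no wall binder, no `def … : Prop`).  HONEST FRAMING (cell contract,
verbatim): «discharging `BetaPertH` makes Bałaban's UV stability UNCONDITIONAL — a real constructive-QFT result; it is NOT the continuum limit
and NOT the Clay problem.»  HONEST DEPENDENCY (verbatim): «continuum YM on T⁴ ⇐ BetaPertH ∧ nine spine estimates (0/9 proved); BetaPertH ⇐
(D1) ∧ (D4) ∧ CAP+tail; G-an2-4 gates asym, D1 and NE2/3/4.»  Discharges NOTHING of (hS, hSall) / «E3SupRate» / «(N1-Cauchy)»; NOT `BetaPertH`,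
NOT continuum, NOT Clay.

## The model (part 3 identifies it with `N^{D+1}·AliasObjects.Ahat N (ofRealVec q) 0 (eVec l) m κ` at `P = qlab q m`)
With the level-free label `P ∈ ℝ^D` on King's zone `|P_i| ≤ 5πN/3`, `P ≠ 0`, `ρ = √momSq P`, and ABSTRACT scaled capacitance data
`φt : Fin D → ℂ`, `ct : ℂ` (part 3: `φt = N^{D+4}·(cap N p)⁻¹_{·,l}`, `ct = N^{D+4}·(cap N p)⁻¹_{c,l}`):
`ampIn N P q φt ct κ = (u/2)·γ_N(P_κ)·φt_κ − (u²/2)·a_N(P_κ)·(Σ_l E_l(q)·φt_l) + u²·a_N(P_κ)·ct`, `u = uS N P = ℓ_N(P)⁻¹`, and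
`ampModel = χ_N(P)·ampIn` — the border-fed block solution `Asol` after the telescoping identity `∂̂♭_l·s♭_l = E_l` (level-free).

## What is proved (`1 ≤ N ≤ N′`, zone, `P ≠ 0`; data bounds `‖φt_l‖ ≤ Φ`, `‖ct‖ ≤ Cc`, rates `‖φt′_l − φt_l‖ ≤ dΦ`, `‖ct′ − ct‖ ≤ dC`; `qn = Σ_l |q_l|`)
* §1 `rho`, `uS`: `uS_le` (`u ≤ 36/ρ²`), `abs_uS_sub_le` (`≤ 216/N²`), `abs_uS_sq_sub_le` (`≤ 559872/(N²ρ²)`) — `FibreRateTBlockRate` BY NAME.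
* §2 `norm_ampIn_le`: `‖ampIn‖ ≤ inB := 18Φ/ρ² + 648·qn·Φ/ρ³ + 1296·Cc/ρ³`; `norm_ampModel_le`: `‖ampModel‖ ≤ WS P · inB`.
* §3 `norm_ampIn_sub_le`: the two-level rate of `ampIn` as the displayed sum `inR` of nine telescoping terms (each `O(1/N)` or `O(ρ/N)` relative
  to the bound); `norm_ampModel_sub_le`: `‖ampModel′ − ampModel‖ ≤ (6/N)·(Σ_i max 12 |P_i|)·WS·inB + WS·inR`.
Part 3 plugs leaf-20's `CapacitanceRateScaled`/`CapacitanceRateDictionary` data (orders `|q|², |q|³`, rates `|q|⁴/N², |q|⁵/N²`) and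
collapses everything to `K·(1 + ρ)/N · WS·momSq q/momSq P` (the `m = 0` poles `1/ρ²`, `1/ρ³` are paid INSIDE the weights by `|q| ≤ ρ`).
Unit `b2b-balaban-gan24-formalise-leaf-16` (G-an2-4 formalisation swarm, leaf prover 16, gen 9), 2026-08-20.
-/

noncomputable section

open Complex Finset
open scoped BigOperators Real

namespace Summit.QuantumFields.BalabanUV.Beta.GAN24.FineReadoutCauchyAmp

open Literature.MathematicalPhysics.QuantumFieldTheory.King1986 (latticeSymbol momSq momSq_nonneg)
open Summit.QuantumFields.BalabanUV.Beta.GAN24.FineReadoutCauchyScalars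
open Summit.QuantumFields.BalabanUV.Beta.GAN24.FibreRateTBlockRate (inv_ell_le abs_inv_ell_two_level_le abs_inv_sq_ell_two_level_le ell_pos)
open Summit.QuantumFields.BalabanUV.Beta.GAN24.ClosedFormRateOfParts (norm_mul_sub_mul_le_of_bounds norm_mul3_sub_mul3_le_of_bounds)

variable {D : ℕ}

/-! ## §1 The label modulus `ρ` and the inverse scaled Laplacian symbol `u_N = ℓ_N⁻¹` -/

/-- [folklore] The Euclidean modulus of the label, `ρ = √momSq P`. -/
def rho (P : Fin D → ℝ) : ℝ := Real.sqrt (momSq P)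

/-- [folklore] `0 ≤ ρ`. -/
theorem rho_nonneg (P : Fin D → ℝ) : 0 ≤ rho P := Real.sqrt_nonneg _

/-- [folklore] `ρ² = momSq P`. -/
theorem rho_sq (P : Fin D → ℝ) : rho P ^ 2 = momSq P := Real.sq_sqrt (momSq_nonneg P)

/-- [folklore] `0 < ρ` for `P ≠ 0` (`momSq P > 0`: leaf-12's `CapacitanceScalarBounds.momSq_pos`, inlined to keep the import cone small). -/
theorem rho_pos {P : Fin D → ℝ} (hP0 : P ≠ 0) : 0 < rho P := by
  have hpos : 0 < momSq P := by
    obtain ⟨i, hi⟩ : ∃ i, P i ≠ 0 := by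
      by_contra h; push Not at h; exact hP0 (funext h)
    exact lt_of_lt_of_le (by positivity : 0 < P i ^ 2) (Finset.single_le_sum (fun j _ => sq_nonneg (P j)) (Finset.mem_univ i))
  exact Real.sqrt_pos.2 hpos

/-- [folklore] Every coordinate is bounded by the modulus: `|P_i| ≤ ρ`. -/
theorem abs_apply_le_rho (P : Fin D → ℝ) (i : Fin D) : |P i| ≤ rho P :=
  Real.abs_le_sqrt (Finset.single_le_sum (fun j _ => sq_nonneg (P j)) (Finset.mem_univ i))

/-- [folklore] THE INVERSE SCALED LAPLACIAN SYMBOL `u_N(P) := ℓ_N(P)⁻¹`, `ℓ_N = latticeSymbol N⁻¹ 0` (`= (N²·LAl)⁻¹` at real momentum, part 3). -/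
def uS (N : ℕ) (P : Fin D → ℝ) : ℝ := (latticeSymbol ((N : ℝ)⁻¹) 0 P)⁻¹

section Symbol

variable {N N' : ℕ} {P : Fin D → ℝ}

/-- [folklore] `0 ≤ u_N(P)` on the zone (`P ≠ 0`). -/
theorem uS_nonneg (hN : 0 < N) (hP : ∀ i, |P i| ≤ 5 * π / 3 * (N : ℝ)) (hP0 : P ≠ 0) : 0 ≤ uS N P := by
  have hN' : (0 : ℝ) < N := by exact_mod_cast hN
  exact (inv_pos.2 (ell_pos hN' hP hP0)).le

/-- [folklore] **`u_N(P) ≤ 36/ρ²`** on the zone (`FibreRateTBlockRate.inv_ell_le` BY NAME). -/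
theorem uS_le (hN : 0 < N) (hP : ∀ i, |P i| ≤ 5 * π / 3 * (N : ℝ)) (hP0 : P ≠ 0) : uS N P ≤ 36 / rho P ^ 2 := by
  have hN' : (0 : ℝ) < N := by exact_mod_cast hN
  rw [rho_sq]; exact inv_ell_le hN' hP hP0

/-- [folklore] `u_N(P)² ≤ 1296/ρ⁴`. -/
theorem uS_sq_le (hN : 0 < N) (hP : ∀ i, |P i| ≤ 5 * π / 3 * (N : ℝ)) (hP0 : P ≠ 0) : uS N P ^ 2 ≤ 1296 / rho P ^ 4 := by
  have h := uS_le hN hP hP0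
  have h0 := uS_nonneg hN hP hP0
  have hρ := rho_pos hP0
  calc uS N P ^ 2 ≤ (36 / rho P ^ 2) ^ 2 := pow_le_pow_left₀ h0 h 2
    _ = 1296 / rho P ^ 4 := by field_simp; ring

/-- [folklore] **`|u_{N′} − u_N| ≤ 216/N²`** (`1 ≤ N ≤ N′`, zone at level `N`). -/
theorem abs_uS_sub_le (hN : 0 < N) (hNN' : N ≤ N') (hP : ∀ i, |P i| ≤ 5 * π / 3 * (N : ℝ)) (hP0 : P ≠ 0) :
    |uS N' P - uS N P| ≤ 216 / (N : ℝ) ^ 2 := by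
  have hN0 : (0 : ℝ) < N := by exact_mod_cast hN
  have hNN : (N : ℝ) ≤ N' := by exact_mod_cast hNN'
  exact abs_inv_ell_two_level_le hN0 hNN hP hP0

/-- [folklore] **`|u_{N′}² − u_N²| ≤ 559872/(N²ρ²)`**. -/
theorem abs_uS_sq_sub_le (hN : 0 < N) (hNN' : N ≤ N') (hP : ∀ i, |P i| ≤ 5 * π / 3 * (N : ℝ)) (hP0 : P ≠ 0) :
    |uS N' P ^ 2 - uS N P ^ 2| ≤ 559872 / ((N : ℝ) ^ 2 * rho P ^ 2) := by
  have hN0 : (0 : ℝ) < N := by exact_mod_cast hN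
  have hNN : (N : ℝ) ≤ N' := by exact_mod_cast hNN'
  have h := abs_inv_sq_ell_two_level_le hN0 hNN hP hP0
  unfold uS
  rw [inv_pow, inv_pow, rho_sq]
  exact h

/-- [folklore] Cast bookkeeping: `‖(u:ℂ)/2‖ = u/2` for `u ≥ 0`. -/
theorem norm_ofReal_div_two {u : ℝ} (hu : 0 ≤ u) : ‖((u : ℂ) / 2)‖ = u / 2 := by
  rw [norm_div, Complex.norm_real, Real.norm_of_nonneg hu]; norm_num

/-- [folklore] `‖(u:ℂ)²‖ = u²`. -/
theorem norm_ofReal_sq (u : ℝ) : ‖((u : ℂ) ^ 2)‖ = u ^ 2 := by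
  rw [norm_pow, Complex.norm_real, Real.norm_eq_abs, sq_abs]

/-- [folklore] `‖(u:ℂ)²/2‖ = u²/2`. -/
theorem norm_ofReal_sq_div_two (u : ℝ) : ‖((u : ℂ) ^ 2 / 2)‖ = u ^ 2 / 2 := by
  rw [norm_div, norm_ofReal_sq]; norm_num

end Symbol

/-! ## §2 The model amplitude and its N-uniform bound -/

/-- [folklore] THE INNER AMPLITUDE (without the block-mean weight `χ`):
`(u/2)·γ_N(P_κ)·φt_κ − (u²/2)·a_N(P_κ)·(Σ_l E_l·φt_l) + u²·a_N(P_κ)·ct`. -/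
def ampIn (N : ℕ) (P q : Fin D → ℝ) (φt : Fin D → ℂ) (ct : ℂ) (κ : Fin D) : ℂ :=
  ((uS N P : ℂ) / 2) * gamS N (P κ) * φt κ - ((uS N P : ℂ) ^ 2 / 2) * aS N (P κ) * (∑ l, ES q l * φt l)
    + ((uS N P : ℂ) ^ 2) * aS N (P κ) * ct

/-- [folklore] THE MODEL AMPLITUDE `χ_N(P)·ampIn` (`= N^{D+1}·Ahat` at real momentum, part 3). -/
def ampModel (N : ℕ) (P q : Fin D → ℝ) (φt : Fin D → ℂ) (ct : ℂ) (κ : Fin D) : ℂ :=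
  chiS N P * ampIn N P q φt ct κ

/-- The ℓ¹ size of the coarse momentum, `qn q = Σ_l |q_l|`. -/
def qn (q : Fin D → ℝ) : ℝ := ∑ l, |q l|

/-- [folklore] `0 ≤ qn q`. -/
theorem qn_nonneg (q : Fin D → ℝ) : 0 ≤ qn q := Finset.sum_nonneg fun _ _ => abs_nonneg _

/-- THE DISPLAYED BOUND of the inner amplitude: `inB ρ qn Φ Cc = 18Φ/ρ² + 648·qn·Φ/ρ³ + 1296·Cc/ρ³`. -/
def inB (ρ qn Φ Cc : ℝ) : ℝ := 18 * Φ / ρ ^ 2 + 648 * qn * Φ / ρ ^ 3 + 1296 * Cc / ρ ^ 3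

/-- [folklore] `0 ≤ inB` for nonnegative arguments, `ρ > 0`. -/
theorem inB_nonneg {ρ qn Φ Cc : ℝ} (hρ : 0 < ρ) (hqn : 0 ≤ qn) (hΦ : 0 ≤ Φ) (hC : 0 ≤ Cc) : 0 ≤ inB ρ qn Φ Cc := by
  unfold inB; positivity

section Bound

variable {N : ℕ} {P q : Fin D → ℝ} {φt : Fin D → ℂ} {ct : ℂ} {Φ Cc : ℝ}

/-- [folklore] `‖Σ_l E_l·φt_l‖ ≤ qn·Φ`. -/
theorem norm_sum_ES_mul_le (q : Fin D → ℝ) (hΦ : ∀ l, ‖φt l‖ ≤ Φ) : ‖∑ l, ES q l * φt l‖ ≤ qn q * Φ := by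
  unfold qn
  rw [Finset.sum_mul]
  refine (norm_sum_le _ _).trans (Finset.sum_le_sum fun l _ => ?_)
  rw [norm_mul]
  exact mul_le_mul (norm_ES_le q l) (hΦ l) (norm_nonneg _) (abs_nonneg _)

/-- [folklore] **THE N-UNIFORM BOUND OF THE INNER AMPLITUDE**: `‖ampIn‖ ≤ inB ρ qn Φ Cc` on the zone, `P ≠ 0`. -/
theorem norm_ampIn_le (hN : 0 < N) (hP : ∀ i, |P i| ≤ 5 * π / 3 * (N : ℝ)) (hP0 : P ≠ 0)
    (hΦ : ∀ l, ‖φt l‖ ≤ Φ) (hC : ‖ct‖ ≤ Cc) (κ : Fin D) :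
    ‖ampIn N P q φt ct κ‖ ≤ inB (rho P) (qn q) Φ Cc := by
  have hρ := rho_pos hP0
  have hu0 := uS_nonneg hN hP hP0
  have hu := uS_le hN hP hP0
  have hu2 := uS_sq_le hN hP hP0
  have hΦ0 : 0 ≤ Φ := (norm_nonneg _).trans (hΦ κ)
  have hC0 : 0 ≤ Cc := (norm_nonneg _).trans hC
  have hqn := qn_nonneg q
  have hγ : ‖gamS N (P κ)‖ ≤ 1 := norm_gamS_le_one N (P κ)
  have ha : ‖aS N (P κ)‖ ≤ rho P := (norm_aS_le N (P κ)).trans (abs_apply_le_rho P κ)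
  have hS := norm_sum_ES_mul_le q hΦ
  -- the three terms
  have h1 : ‖((uS N P : ℂ) / 2) * gamS N (P κ) * φt κ‖ ≤ 18 * Φ / rho P ^ 2 := by
    rw [norm_mul, norm_mul, norm_ofReal_div_two hu0]
    calc uS N P / 2 * ‖gamS N (P κ)‖ * ‖φt κ‖ ≤ (36 / rho P ^ 2) / 2 * 1 * Φ :=
          mul_le_mul (mul_le_mul (by linarith) hγ (norm_nonneg _) (by positivity)) (hΦ κ) (norm_nonneg _) (by positivity)
      _ = 18 * Φ / rho P ^ 2 := by ring
  have h2 : ‖((uS N P : ℂ) ^ 2 / 2) * aS N (P κ) * (∑ l, ES q l * φt l)‖ ≤ 648 * qn q * Φ / rho P ^ 3 := by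
    rw [norm_mul, norm_mul, norm_ofReal_sq_div_two]
    calc uS N P ^ 2 / 2 * ‖aS N (P κ)‖ * ‖∑ l, ES q l * φt l‖ ≤ (1296 / rho P ^ 4) / 2 * rho P * (qn q * Φ) :=
          mul_le_mul (mul_le_mul (by linarith) ha (norm_nonneg _) (by positivity)) hS (norm_nonneg _) (by positivity)
      _ = 648 * qn q * Φ / rho P ^ 3 := by field_simp; ring
  have h3 : ‖((uS N P : ℂ) ^ 2) * aS N (P κ) * ct‖ ≤ 1296 * Cc / rho P ^ 3 := by
    rw [norm_mul, norm_mul, norm_ofReal_sq]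
    calc uS N P ^ 2 * ‖aS N (P κ)‖ * ‖ct‖ ≤ (1296 / rho P ^ 4) * rho P * Cc :=
          mul_le_mul (mul_le_mul hu2 ha (norm_nonneg _) (by positivity)) hC (norm_nonneg _) (by positivity)
      _ = 1296 * Cc / rho P ^ 3 := by field_simp
  unfold ampIn inB
  calc ‖((uS N P : ℂ) / 2) * gamS N (P κ) * φt κ - ((uS N P : ℂ) ^ 2 / 2) * aS N (P κ) * (∑ l, ES q l * φt l)
        + ((uS N P : ℂ) ^ 2) * aS N (P κ) * ct‖
      ≤ ‖((uS N P : ℂ) / 2) * gamS N (P κ) * φt κ‖ + ‖((uS N P : ℂ) ^ 2 / 2) * aS N (P κ) * (∑ l, ES q l * φt l)‖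
        + ‖((uS N P : ℂ) ^ 2) * aS N (P κ) * ct‖ := by
        exact (norm_add_le _ _).trans (add_le_add (norm_sub_le _ _) le_rfl)
    _ ≤ 18 * Φ / rho P ^ 2 + 648 * qn q * Φ / rho P ^ 3 + 1296 * Cc / rho P ^ 3 := add_le_add (add_le_add h1 h2) h3

/-- [folklore] **THE N-UNIFORM BOUND OF THE MODEL AMPLITUDE**: `‖ampModel‖ ≤ WS P · inB ρ qn Φ Cc`. -/
theorem norm_ampModel_le (hN : 0 < N) (hP : ∀ i, |P i| ≤ 5 * π / 3 * (N : ℝ)) (hP0 : P ≠ 0)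
    (hΦ : ∀ l, ‖φt l‖ ≤ Φ) (hC : ‖ct‖ ≤ Cc) (κ : Fin D) :
    ‖ampModel N P q φt ct κ‖ ≤ WS P * inB (rho P) (qn q) Φ Cc := by
  unfold ampModel
  rw [norm_mul]
  have hΦ0 : 0 ≤ Φ := (norm_nonneg _).trans (hΦ κ)
  exact mul_le_mul (norm_chiS_le_WS hN hP) (norm_ampIn_le hN hP hP0 hΦ hC κ) (norm_nonneg _) (WS_pos P).le

end Bound

/-! ## §3 The two-level rate -/

/-- THE DISPLAYED TWO-LEVEL RATE of the inner amplitude (nine telescoping terms; `Nr = N`, `ρ`, data bounds/rates):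
`inR = [108/N²·1·Φ + (18/ρ²)(72/N)Φ + (18/ρ²)·1·dΦ] + [279936/(N²ρ²)·ρ·qnΦ + (648/ρ⁴)(ρ²/N)qnΦ + (648/ρ⁴)ρ·qn·dΦ]
      + [559872/(N²ρ²)·ρ·Cc + (1296/ρ⁴)(ρ²/N)Cc + (1296/ρ⁴)ρ·dC]`. -/
def inR (Nr ρ qn Φ Cc dΦ dC : ℝ) : ℝ :=
  (108 / Nr ^ 2 * 1 * Φ + 18 / ρ ^ 2 * (72 / Nr) * Φ + 18 / ρ ^ 2 * 1 * dΦ)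
  + (279936 / (Nr ^ 2 * ρ ^ 2) * ρ * (qn * Φ) + 648 / ρ ^ 4 * (ρ ^ 2 / Nr) * (qn * Φ) + 648 / ρ ^ 4 * ρ * (qn * dΦ))
  + (559872 / (Nr ^ 2 * ρ ^ 2) * ρ * Cc + 1296 / ρ ^ 4 * (ρ ^ 2 / Nr) * Cc + 1296 / ρ ^ 4 * ρ * dC)

section Rate

variable {N N' : ℕ} {P q : Fin D → ℝ} {φt φt' : Fin D → ℂ} {ct ct' : ℂ} {Φ Cc dΦ dC : ℝ}

/-- [folklore] `‖Σ_l E_l·(φt′_l − φt_l)‖ ≤ qn·dΦ` and the difference of the sums. -/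
theorem norm_sum_ES_mul_sub_le (q : Fin D → ℝ) (hd : ∀ l, ‖φt' l - φt l‖ ≤ dΦ) :
    ‖(∑ l, ES q l * φt' l) - ∑ l, ES q l * φt l‖ ≤ qn q * dΦ := by
  rw [← Finset.sum_sub_distrib]
  have e : ∀ l, ES q l * φt' l - ES q l * φt l = ES q l * (φt' l - φt l) := fun l => by ring
  simp_rw [e]
  unfold qn
  rw [Finset.sum_mul]
  refine (norm_sum_le _ _).trans (Finset.sum_le_sum fun l _ => ?_)
  rw [norm_mul]
  exact mul_le_mul (norm_ES_le q l) (hd l) (norm_nonneg _) (abs_nonneg _)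

/-- [folklore] **THE TWO-LEVEL RATE OF THE INNER AMPLITUDE** (`1 ≤ N ≤ N′`, zone at level `N`, `P ≠ 0`; data bounds (`φt` at both levels, `ct′`), data rates):
`‖ampIn N′ … φt′ ct′ − ampIn N … φt ct‖ ≤ inR N ρ qn Φ Cc dΦ dC`. -/
theorem norm_ampIn_sub_le (hN : 0 < N) (hNN' : N ≤ N') (hP : ∀ i, |P i| ≤ 5 * π / 3 * (N : ℝ)) (hP0 : P ≠ 0)
    (hΦ : ∀ l, ‖φt l‖ ≤ Φ) (hΦ' : ∀ l, ‖φt' l‖ ≤ Φ) (hC' : ‖ct'‖ ≤ Cc)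
    (hdΦ : ∀ l, ‖φt' l - φt l‖ ≤ dΦ) (hdC : ‖ct' - ct‖ ≤ dC) (κ : Fin D) :
    ‖ampIn N' P q φt' ct' κ - ampIn N P q φt ct κ‖ ≤ inR N (rho P) (qn q) Φ Cc dΦ dC := by
  have hN' : 0 < N' := lt_of_lt_of_le hN hNN'
  have hP' : ∀ i, |P i| ≤ 5 * π / 3 * (N' : ℝ) := fun i => (hP i).trans (by gcongr)
  have hρ := rho_pos hP0
  have hu0 := uS_nonneg hN hP hP0
  have hu0' := uS_nonneg hN' hP' hP0
  have hu := uS_le hN hP hP0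
  have hu' := uS_le hN' hP' hP0
  have hu2 := uS_sq_le hN hP hP0
  have hu2' := uS_sq_le hN' hP' hP0
  have hdu := abs_uS_sub_le hN hNN' hP hP0
  have hdu2 := abs_uS_sq_sub_le hN hNN' hP hP0
  have hΦ0 : 0 ≤ Φ := (norm_nonneg _).trans (hΦ κ)
  have hqn := qn_nonneg q
  have hγ : ‖gamS N (P κ)‖ ≤ 1 := norm_gamS_le_one N (P κ)
  have hγ' : ‖gamS N' (P κ)‖ ≤ 1 := norm_gamS_le_one N' (P κ)
  have hdγ : ‖gamS N' (P κ) - gamS N (P κ)‖ ≤ 72 / N := norm_gamS_sub_gamS_le hN hNN' (hP κ)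
  have ha : ‖aS N (P κ)‖ ≤ rho P := (norm_aS_le N (P κ)).trans (abs_apply_le_rho P κ)
  have ha' : ‖aS N' (P κ)‖ ≤ rho P := (norm_aS_le N' (P κ)).trans (abs_apply_le_rho P κ)
  have hda : ‖aS N' (P κ) - aS N (P κ)‖ ≤ rho P ^ 2 / N := by
    refine (norm_aS_sub_aS_le hN hNN' (P κ)).trans ?_
    have : P κ ^ 2 ≤ rho P ^ 2 := by
      rw [← sq_abs]; exact pow_le_pow_left₀ (abs_nonneg _) (abs_apply_le_rho P κ) 2
    gcongr
  have hS' : ‖∑ l, ES q l * φt' l‖ ≤ qn q * Φ := norm_sum_ES_mul_le q hΦ'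
  have hdS := norm_sum_ES_mul_sub_le q hdΦ
  -- cast bookkeeping for the real prefactors
  have hA1 : ‖((uS N P : ℂ) / 2)‖ ≤ 18 / rho P ^ 2 := by
    rw [norm_ofReal_div_two hu0]
    calc uS N P / 2 ≤ (36 / rho P ^ 2) / 2 := by linarith
      _ = 18 / rho P ^ 2 := by ring
  have hdA1 : ‖((uS N' P : ℂ) / 2) - ((uS N P : ℂ) / 2)‖ ≤ 108 / (N : ℝ) ^ 2 := by
    rw [← sub_div, norm_div, ← Complex.ofReal_sub, Complex.norm_real, Real.norm_eq_abs, Complex.norm_two]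
    calc |uS N' P - uS N P| / 2 ≤ (216 / (N : ℝ) ^ 2) / 2 := by linarith
      _ = 108 / (N : ℝ) ^ 2 := by ring
  have hA2 : ‖((uS N P : ℂ) ^ 2 / 2)‖ ≤ 648 / rho P ^ 4 := by
    rw [norm_ofReal_sq_div_two]
    calc uS N P ^ 2 / 2 ≤ (1296 / rho P ^ 4) / 2 := by linarith
      _ = 648 / rho P ^ 4 := by ring
  have hdA2 : ‖((uS N' P : ℂ) ^ 2 / 2) - ((uS N P : ℂ) ^ 2 / 2)‖ ≤ 279936 / ((N : ℝ) ^ 2 * rho P ^ 2) := by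
    rw [← sub_div, norm_div, ← Complex.ofReal_pow, ← Complex.ofReal_pow, ← Complex.ofReal_sub, Complex.norm_real, Real.norm_eq_abs,
      Complex.norm_two]
    calc |uS N' P ^ 2 - uS N P ^ 2| / 2 ≤ (559872 / ((N : ℝ) ^ 2 * rho P ^ 2)) / 2 := by linarith
      _ = 279936 / ((N : ℝ) ^ 2 * rho P ^ 2) := by ring
  have hA3 : ‖((uS N P : ℂ) ^ 2)‖ ≤ 1296 / rho P ^ 4 := by rw [norm_ofReal_sq]; exact hu2
  have hdA3 : ‖((uS N' P : ℂ) ^ 2) - ((uS N P : ℂ) ^ 2)‖ ≤ 559872 / ((N : ℝ) ^ 2 * rho P ^ 2) := by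
    rw [← Complex.ofReal_pow, ← Complex.ofReal_pow, ← Complex.ofReal_sub, Complex.norm_real, Real.norm_eq_abs]
    exact hdu2
  -- the three telescoped terms
  have h1 := norm_mul3_sub_mul3_le_of_bounds hA1 hγ hγ' (hΦ' κ) hdA1 hdγ (hdΦ κ)
  have h2 := norm_mul3_sub_mul3_le_of_bounds hA2 ha ha' hS' hdA2 hda hdS
  have h3 := norm_mul3_sub_mul3_le_of_bounds hA3 ha ha' hC' hdA3 hda hdC
  unfold ampIn inR
  have e : ((uS N' P : ℂ) / 2) * gamS N' (P κ) * φt' κ - ((uS N' P : ℂ) ^ 2 / 2) * aS N' (P κ) * (∑ l, ES q l * φt' l)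
        + ((uS N' P : ℂ) ^ 2) * aS N' (P κ) * ct'
      - (((uS N P : ℂ) / 2) * gamS N (P κ) * φt κ - ((uS N P : ℂ) ^ 2 / 2) * aS N (P κ) * (∑ l, ES q l * φt l)
        + ((uS N P : ℂ) ^ 2) * aS N (P κ) * ct)
      = (((uS N' P : ℂ) / 2) * gamS N' (P κ) * φt' κ - ((uS N P : ℂ) / 2) * gamS N (P κ) * φt κ)
        - (((uS N' P : ℂ) ^ 2 / 2) * aS N' (P κ) * (∑ l, ES q l * φt' l) - ((uS N P : ℂ) ^ 2 / 2) * aS N (P κ) * (∑ l, ES q l * φt l))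
        + (((uS N' P : ℂ) ^ 2) * aS N' (P κ) * ct' - ((uS N P : ℂ) ^ 2) * aS N (P κ) * ct) := by ring
  rw [e]
  refine ((norm_add_le _ _).trans (add_le_add (norm_sub_le _ _) le_rfl)).trans ?_
  exact add_le_add (add_le_add h1 h2) h3

/-- [folklore] **THE TWO-LEVEL RATE OF THE MODEL AMPLITUDE**: with `Σmax = Σ_i max 12 |P_i|`,
`‖ampModel N′ … φt′ ct′ − ampModel N … φt ct‖ ≤ (6/N)·Σmax·WS·inB + WS·inR`. -/
theorem norm_ampModel_sub_le (hN : 0 < N) (hNN' : N ≤ N') (hP : ∀ i, |P i| ≤ 5 * π / 3 * (N : ℝ)) (hP0 : P ≠ 0)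
    (hΦ : ∀ l, ‖φt l‖ ≤ Φ) (hΦ' : ∀ l, ‖φt' l‖ ≤ Φ) (hC' : ‖ct'‖ ≤ Cc)
    (hdΦ : ∀ l, ‖φt' l - φt l‖ ≤ dΦ) (hdC : ‖ct' - ct‖ ≤ dC) (κ : Fin D) :
    ‖ampModel N' P q φt' ct' κ - ampModel N P q φt ct κ‖
      ≤ 6 / N * (∑ i, max 12 |P i|) * WS P * inB (rho P) (qn q) Φ Cc + WS P * inR N (rho P) (qn q) Φ Cc dΦ dC := by
  have hN' : 0 < N' := lt_of_lt_of_le hN hNN'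
  have hP' : ∀ i, |P i| ≤ 5 * π / 3 * (N' : ℝ) := fun i => (hP i).trans (by gcongr)
  unfold ampModel
  exact norm_mul_sub_mul_le_of_bounds (norm_chiS_le_WS hN hP) (norm_ampIn_le hN' hP' hP0 hΦ' hC' κ)
    (norm_chiS_sub_chiS_le hN hNN' hP) (norm_ampIn_sub_le hN hNN' hP hP0 hΦ hΦ' hC' hdΦ hdC κ)

end Rate

end Summit.QuantumFields.BalabanUV.Beta.GAN24.FineReadoutCauchyAmp

end
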